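import Summits.BirchSwinnertonDyer.BirchSwinnertonDyer.Theses.KolyvaginDepthDoor
import Summits.BirchSwinnertonDyer.BirchSwinnertonDyer.Theorems.KolyvaginDepthDoorDepthTableGlobalMinimal
import Literature.NumberTheory.EllipticCurves.ZywinaCMImageProofs
import Literature.NumberTheory.EllipticCurves.ComplexMultiplicationHasCMProofs
import HarnessLib

/-!
# Theorems/KolyvaginDepthSupplyKN/Negative — the hypothesis `¬ W.HasCM` of `KolyvaginDepthSupplyKN` is load-bearing (and implied by the conclusion)

Negative-lane helper for item stmt-BirchSwinnertonDyer-22820 (route `KolyvaginDepthDoor` rev 4, crux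
`Theses.KolyvaginDepthDoor.KolyvaginDepthSupplyKN`, definitionally `Theorems.KolyvaginDepthDoor.KolyvaginDepthSupplySignedDatumKN`),
written by the grounding-vet refuter (`bsd-vet-kdd22820` g0). It closes nothing, refutes no ledger item, asserts no
Theses statement positively, declares no definition, and BSD is not proved by any of this.

CONTENT (hypothesis-mutation record of the vet; sorry-free, axioms `propext` / `Classical.choice` / `Quot.sound`):

* `not_hasCM_of_surjective_tower` — the KN cell FORCES non-CM: its tower clause `∀ n, ρ_{E,p^n} onto` at `n = 1`
  makes `ρ̄_{E,p}` onto `Aut(E[p])` at a prime `p ≠ 2`, which no CM curve has (Zywina 2015, Prop. 1.14 / Serre 1972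
  §4.5; tree theorem `WeierstrassCurve.not_hasSurjectiveModNGaloisRep_of_hasCM`). So the hypothesis `¬ W.HasCM` of the
  item is implied by its conclusion (`not_hasCM_of_kolyvaginDepthSupplyKN_conclusion`), i.e. the item is equivalent to
  the hypothesis-free `∀ W, W.HasCM ∨ (conclusion)`.
* `kolyvaginDepthSupplyKN_false_without_nonCM` — with `¬ W.HasCM` DROPPED the statement is false: witness the CM curve
  `y² = x³ + x` (`[0,0,0,1,0]`, `Δ = -64`, `j = 1728`; globally minimal by the tree's small-discriminant criterion
  `isGloballyMinimal_map_int_of_natAbs_Δ_lt`; CM by `WeierstrassCurve.hasCM_ofJ1728`). So any proof of the item must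
  use `¬ W.HasCM`, and the CM class is exactly what the sibling crux `ShaCorankZeroAtOnePrimeOfCM` (stmt-21766) covers
  in `closes`. (That the hypotheses are satisfiable — a non-CM globally minimal elliptic `E/ℚ` exists — is already
  landed: `Theorems.TamePinchR.Negative.hypotheses_satisfiable`, and `Theorems.KolyvaginDepthDoor.not_hasCM_twist480a1`.)

References: [Zywina2015] Prop. 1.14, 1.16; [Serre1972] §4.5; [SilvermanAEC2009] III Ex. 4.4, VII.1 Rem. 1.1, App. C §11.
-/

set_option autoImplicit false
-- the Theorems namespace of this sub repeats the summit name by design (D-0017 nested layout: Summit.<S>.<Sub>)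
set_option linter.dupNamespace false

noncomputable section

open WeierstrassCurve Literature.NumberTheory.EllipticCurves

namespace Summit.BirchSwinnertonDyer.BirchSwinnertonDyer.Theorems.KolyvaginDepthSupplyKNNegative

open Summit.BirchSwinnertonDyer.BirchSwinnertonDyer.Theorems.KolyvaginDepthDoor
open Summit.BirchSwinnertonDyer.BirchSwinnertonDyer.Theses

/-! ## §1 the KN tower clause forces `¬ W.HasCM` -/

/-- A curve whose `p`-adic tower of Galois representations is surjective at every level `p ^ n` for an odd prime
`p` (already the level `n = 1`, i.e. `ρ̄_{E,p}` onto) has no complex multiplication (Zywina 2015 Prop. 1.14: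
the mod-`ℓ` image of a CM curve is never all of `GL₂(𝔽_ℓ)` for odd `ℓ`). [cite: Zywina2015, Prop. 1.14] -/
theorem not_hasCM_of_surjective_tower (W : WeierstrassCurve ℚ) [W.IsElliptic] {p : ℕ} (hp : p.Prime) (hp2 : p ≠ 2)
    (hsurj : ∀ n : ℕ, W.HasSurjectiveModNGaloisRep (p ^ n : ℕ)) : ¬ W.HasCM := by
  intro hCM
  have h1 := hsurj 1
  rw [pow_one] at h1
  exact W.not_hasSurjectiveModNGaloisRep_of_hasCM hCM hp hp2 h1

/-- **The hypothesis `¬ W.HasCM` of `KolyvaginDepthSupplyKN` is implied by its conclusion** (stated for one curve,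
conclusion verbatim): the KN cell contains `5 ≤ p` and the surjective tower, hence `not_hasCM_of_surjective_tower`.
[cite: Zywina2015, Prop. 1.14] -/
theorem not_hasCM_of_kolyvaginDepthSupplyKN_conclusion (W : WeierstrassCurve ℚ) [W.IsElliptic]
    [W.IsGloballyMinimal]
    (h : ∃ (p : ℕ) (hp : Fact p.Prime), 5 ≤ p ∧ W.HasGoodReductionAtPrime p ∧ ¬ (p : ℤ) ∣ W.frobeniusTrace p ∧ (∀ n : ℕ, W.HasSurjectiveModNGaloisRep (p ^ n : ℕ)) ∧ (∀ v : IsDedekindDomain.HeightOneSpectrum (NumberField.RingOfIntegers ℚ), W.HasMultiplicativeReductionAt v → ¬ p ∣ W.ordMinimalDiscriminant v) ∧ ∃ (K : Type) (_ : Field K) (_ : NumberField K), Literature.NumberTheory.EllipticCurves.IsImaginaryQuadratic K ∧ NumberField.discr K ≠ -3 ∧ NumberField.discr K ≠ -4 ∧ ∃ (_ : NeZero (W.conductorNorm ℤ)), Literature.NumberTheory.EllipticCurves.SatisfiesHeegnerHypothesis (W.conductorNorm ℤ) K ∧ ∃ (Dt : Literature.NumberTheory.EllipticCurves.ModularForms.ModularParametrizationData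 W (W.conductorNorm ℤ)) (β : ℤ) (ι : K →+* ℂ) (n₁ : ℕ) (d : Literature.NumberTheory.EllipticCurves.KolyvaginHeegnerData Dt β ι n₁), Squarefree n₁ ∧ (∀ q ∈ n₁.primeFactors, Literature.NumberTheory.EllipticCurves.Zhang2014.IsKolyvaginPrime (W.conductorNorm ℤ) W K p q) ∧ d.kolyvaginClass hp.out 1 ≠ 0 ∧ (n₁.primeFactors.card + 1 ≤ W.mordellWeilRank ∨ (n₁.primeFactors.card ≤ W.mordellWeilRank ∧ n₁.primeFactors.card + 1 ≤ (W.quadraticTwist (NumberField.discr K : ℚ)).mordellWeilRank))) :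
    ¬ W.HasCM := by
  obtain ⟨p, hp, h5, -, -, hsurj, -⟩ := h
  exact not_hasCM_of_surjective_tower W hp.out (by omega) hsurj

/-! ## §2 mutation: dropping `¬ W.HasCM` makes the statement false -/

/-- `y² = x³ + x` (`[0,0,0,1,0]`, `Δ = -64 ≠ 0`) is an elliptic curve. [cite: SilvermanAEC2009, III.1] -/
theorem isElliptic_j1728 : ((⟨0, 0, 0, 1, 0⟩ : WeierstrassCurve ℤ).map (Int.castRingHom ℚ)).IsElliptic := by
  rw [WeierstrassCurve.isElliptic_iff, WeierstrassCurve.map_Δ, isUnit_iff_ne_zero, eq_intCast,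
    Int.cast_ne_zero]
  decide +kernel

/-- `[0,0,0,1,0]` is a global minimal equation over `ℚ` (`|Δ| = 64 < 3¹²`, `2¹² ∤ Δ`; kernel-checked via
`isGloballyMinimal_map_int_of_natAbs_Δ_lt`). [cite: SilvermanAEC2009, VII.1 Remark 1.1] -/
theorem isGloballyMinimal_j1728 :
    ((⟨0, 0, 0, 1, 0⟩ : WeierstrassCurve ℤ).map (Int.castRingHom ℚ)).IsGloballyMinimal :=
  isGloballyMinimal_map_int_of_natAbs_Δ_lt _ (by decide +kernel) (by decide +kernel) (by decide +kernel)

/-- The integral equation `[0,0,0,1,0]` read over `ℚ` is Mathlib's `ofJ1728 ℚ`. -/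
theorem map_j1728_eq_ofJ1728 :
    (⟨0, 0, 0, 1, 0⟩ : WeierstrassCurve ℤ).map (Int.castRingHom ℚ) = WeierstrassCurve.ofJ1728 ℚ := by
  ext <;> simp [WeierstrassCurve.ofJ1728, WeierstrassCurve.map]

/-- `y² = x³ + x` has complex multiplication (by `ℤ[i]`; tree theorem `WeierstrassCurve.hasCM_ofJ1728`).
[cite: SilvermanAEC2009, III Example 4.4] -/
theorem hasCM_j1728 : ((⟨0, 0, 0, 1, 0⟩ : WeierstrassCurve ℤ).map (Int.castRingHom ℚ)).HasCM := by
  rw [map_j1728_eq_ofJ1728]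
  exact WeierstrassCurve.hasCM_ofJ1728

/-- **Any proof of `KolyvaginDepthSupplyKN` must use `¬ W.HasCM`** — the statement with that hypothesis dropped
(body otherwise verbatim) is FALSE, witnessed by the CM curve `y² = x³ + x`: its conclusion would force `ρ̄_{E,p}`
onto for some `p ≥ 5`, impossible for a CM curve. [cite: Zywina2015, Prop. 1.14] [cite: SilvermanAEC2009, III Example 4.4] -/
theorem kolyvaginDepthSupplyKN_false_without_nonCM :
    ¬ (∀ (W : WeierstrassCurve ℚ) [W.IsElliptic] [W.IsGloballyMinimal], ∃ (p : ℕ) (hp : Fact p.Prime), 5 ≤ p ∧ W.HasGoodReductionAtPrime p ∧ ¬ (p : ℤ) ∣ W.frobeniusTrace p ∧ (∀ n : ℕ, W.HasSurjectiveModNGaloisRep (p ^ n : ℕ)) ∧ (∀ v : IsDedekindDomain.HeightOneSpectrum (NumberField.RingOfIntegers ℚ), W.HasMultiplicativeReductionAt v → ¬ p ∣ W.ordMinimalDiscriminant v) ∧ ∃ (K : Type) (_ : Field K) (_ : NumberField K), Literature.NumberTheory.EllipticCurves.IsImaginaryQuadratic K ∧ NumberField.discr K ≠ -3 ∧ NumberField.discr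 K ≠ -4 ∧ ∃ (_ : NeZero (W.conductorNorm ℤ)), Literature.NumberTheory.EllipticCurves.SatisfiesHeegnerHypothesis (W.conductorNorm ℤ) K ∧ ∃ (Dt : Literature.NumberTheory.EllipticCurves.ModularForms.ModularParametrizationData W (W.conductorNorm ℤ)) (β : ℤ) (ι : K →+* ℂ) (n₁ : ℕ) (d : Literature.NumberTheory.EllipticCurves.KolyvaginHeegnerData Dt β ι n₁), Squarefree n₁ ∧ (∀ q ∈ n₁.primeFactors, Literature.NumberTheory.EllipticCurves.Zhang2014.IsKolyvaginPrime (W.conductorNorm ℤ) W K p q) ∧ d.kolyvaginClass hp.out 1 ≠ 0 ∧ (n₁.primeFactors.card + 1 ≤ W.mordellWeilRank ∨ (n₁.primeFactors.card ≤ W.mordellWeilRank ∧ n₁.primeFactors.card + 1 ≤ (W.quadraticTwist (NumberField.discr K : ℚ)).mordellWeilRank))) := by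
  intro h
  haveI := isElliptic_j1728
  haveI := isGloballyMinimal_j1728
  exact not_hasCM_of_kolyvaginDepthSupplyKN_conclusion _ (h _) hasCM_j1728

end Summit.BirchSwinnertonDyer.BirchSwinnertonDyer.Theorems.KolyvaginDepthSupplyKNNegative
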